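import Summits.Parity.GeneralizedHardyLittlewood.Theorems.PrimeLevelFamEdgeMomentsBeyondDiagonalDiagSelberg
import HarnessLib

/-!
# Route `PrimeLevelFamEdge`, crux K_A `MomentsBeyondDiagonal` (stmt-Parity-20007), line «petersson_layers» v4, stub `stub_diag`:
# **the kernel form of a general profile in Selberg coordinates** —
# `Σ_{a,b≤M} x_a x_b K_L(a,b) = Σ_n φ(n)W(n)²((L+κ(n))𝒮_n² + 2𝒮_n𝒫_n)`, `𝒮_n = Σ_c P_c S⁽ᶜ⁾(M/n;n)/logᶜM`

Census item R3(i) of the `stub_diag` roadmap (generalising K_B's `KernelFormXSqBridge.quadForm_xsq_eq` from the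
profile `X²` to an arbitrary real polynomial `P`). For the coefficients `x_m = μ(m)ψ(m)⁻¹P(log(M/m)/log M)`
(`= m^{1/2}·KMV2000.mollifierCoeff P M m`):

* `selA_profile` — `A_n(x) = W(n)·𝒮_n`, `𝒮_n = Σ_{c ≤ deg P} P_c·S⁽ᶜ⁾(M/n;n)/logᶜM`
  (`S⁽ᶜ⁾(y;n) = Σ_{k≤y,(k,n)=1}τ(k)W(k)logᶜ(y/k)`, evaluated in `…DiagCoprime`/`KernelFormXSqCore`);
* `sum_wt_selA_profile` — the von Mangoldt coupling collapses to primes: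
  `Σ_m w(n,m)A_m = −φ(n)W(n)·𝒫_n`, `𝒫_n = Σ_{p ≤ M/n, p∤n}(log p/(p+1))·𝒮_{np}`;
* `quadForm_profile_eq` — **`Σ_{a,b ≤ M} x_a x_b K_L(a,b) = Σ_{n ≤ M} φ(n)W(n)²((L + κ(n))𝒮_n² + 2𝒮_n𝒫_n)`**.

With `S⁽ᶜ⁾(M/n;n) ≈ c(c−1)E_n log^{c−2}(M/n)` this reads `𝒮_n ≈ E_n·P″(log(M/n)/log M)/log²M`: the general-profile
kernel asymptotics (remaining: the `n`-sums of `KernelFormXSqSums/SumsB/Collapse/Errors` with the weight `P″(u_n)²`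
in place of `4`). Def-free; theorems only. Helper `--supports stmt-Parity-20007`; closes nothing; K_A, K_B and the
Parity summit are NOT proved; nothing about Landau–Siegel zeros.

## References
* E. Kowalski, P. Michel, J. VanderKam, J. reine angew. Math. 526 (2000), (21)–(23) pp. 12–13 and Prop. 5.1 p. 18.
  [cite: KowalskiMichelVanderKam2000, (21)–(23) — derivation]
-/

noncomputable section

open scoped Real ArithmeticFunction.Moebius ArithmeticFunction.sigma ArithmeticFunction.zeta
open Finset ArithmeticFunction Polynomial

namespace Summit.Parity.GeneralizedHardyLittlewood.Theorems.MomentsBeyondDiagonal.DiagKernel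

open Literature.NumberTheory.LFunctions Literature.NumberTheory.LFunctions.KMV2000
open MollifierMainTerm (W)
open SelbergCoord (kappa wt scForm selA tauR quadForm_kmvKernel_eq_scForm)
open Summit.Parity.GeneralizedHardyLittlewood.Theorems.BeyondDiagonalBeatsQuarter.KernelFormXSq
  (copTauW sum_Icc_ite_dvd_eq vonMangoldt_mul_W_mul)

/-- **`A_n(x) = W(n)·𝒮_n`** for the coefficients `x_m = μ(m)ψ(m)⁻¹P(log(M/m)/log M)` of a real polynomial
`P` (`n ≥ 1`), `𝒮_n = Σ_{c ≤ deg P} P_c·S⁽ᶜ⁾(M/n;n)/logᶜM`.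
[cite: KowalskiMichelVanderKam2000, (23) — derivation (Selberg coordinates of the mollifier with profile P)] -/
theorem selA_profile (P : ℝ[X]) (M : ℝ) {n : ℕ} (hn : n ≠ 0) :
    selA ⌊M⌋₊ (fun m ↦ (μ m : ℝ) * ((psi m)⁻¹ * P.eval (Real.log (M / m) / Real.log M))) n =
      W n * ∑ c ∈ Finset.range (P.natDegree + 1), P.coeff c *
        ((∑ k ∈ Icc 1 ⌊M / n⌋₊, copTauW n k * Real.log (M / n / k) ^ c) / Real.log M ^ c) := by
  have hx : (fun m : ℕ ↦ (μ m : ℝ) * ((psi m)⁻¹ * P.eval (Real.log (M / m) / Real.log M))) =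
      fun m ↦ ∑ c ∈ Finset.range (P.natDegree + 1), P.coeff c *
        ((μ m : ℝ) * ((psi m)⁻¹ * (Real.log (M / m) / Real.log M) ^ c)) := by
    funext m
    rw [Polynomial.eval_eq_sum_range, Finset.mul_sum, Finset.mul_sum]
    exact Finset.sum_congr rfl fun c _ ↦ by ring
  rw [hx, selA_sum_mul, Finset.mul_sum]
  refine Finset.sum_congr rfl fun c _ ↦ ?_
  rw [selA_pow M c hn]
  ring

/-- **The von Mangoldt coupling of the general-profile Selberg coordinates**:
`Σ_{m ≤ M} w(n,m)·A_m = −φ(n)W(n)·𝒫_n`, `𝒫_n = Σ_{p ≤ ⌊M⌋/n, p prime, p∤n}(log p/(p+1))·𝒮_{np}` (`n ≥ 1`).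
[cite: KowalskiMichelVanderKam2000, (23) — derivation] -/
theorem sum_wt_selA_profile (P : ℝ[X]) (M : ℝ) {n : ℕ} (hn : n ≠ 0) :
    ∑ m ∈ Icc 1 ⌊M⌋₊, wt n m *
        selA ⌊M⌋₊ (fun m ↦ (μ m : ℝ) * ((psi m)⁻¹ * P.eval (Real.log (M / m) / Real.log M))) m =
      -((Nat.totient n : ℝ) * W n *
        ∑ j ∈ Icc 1 (⌊M⌋₊ / n), if j.Prime ∧ ¬ j ∣ n then
          Real.log j / ((j : ℝ) + 1) *
            ∑ c ∈ Finset.range (P.natDegree + 1), P.coeff c *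
              ((∑ k ∈ Icc 1 ⌊M / ((n * j : ℕ) : ℝ)⌋₊,
                copTauW (n * j) k * Real.log (M / ((n * j : ℕ) : ℝ) / k) ^ c) / Real.log M ^ c)
          else 0) := by
  set x : ℕ → ℝ := fun m ↦ (μ m : ℝ) * ((psi m)⁻¹ * P.eval (Real.log (M / m) / Real.log M)) with hxdef
  have h1 : ∀ m ∈ Icc 1 ⌊M⌋₊, wt n m * selA ⌊M⌋₊ x m =
      if n ∣ m then (Nat.totient n : ℝ) * Λ (m / n) * selA ⌊M⌋₊ x m else 0 := by
    intro m hm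
    unfold wt
    by_cases hnm : n ∣ m
    · by_cases hlt : n < m
      · rw [if_pos ⟨hnm, hlt⟩, if_pos hnm]
      · have hmn : m = n := by
          have := Nat.le_of_dvd (by have := (Finset.mem_Icc.1 hm).1; omega) hnm
          omega
        subst hmn
        rw [if_neg (fun h ↦ hlt h.2), if_pos hnm, Nat.div_self (Nat.pos_of_ne_zero hn),
          vonMangoldt_apply_one]
        ring
    · rw [if_neg (fun h ↦ hnm h.1), if_neg hnm, zero_mul]
  rw [Finset.sum_congr rfl h1, sum_Icc_ite_dvd_eq hn, Finset.mul_sum, ← Finset.sum_neg_distrib]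
  refine Finset.sum_congr rfl fun j hj ↦ ?_
  have hj0 : j ≠ 0 := by have := (Finset.mem_Icc.1 hj).1; omega
  rw [Nat.mul_div_cancel_left j (Nat.pos_of_ne_zero hn), hxdef, selA_profile P M (mul_ne_zero hn hj0)]
  set S : ℝ := ∑ c ∈ Finset.range (P.natDegree + 1), P.coeff c *
    ((∑ k ∈ Icc 1 ⌊M / ((n * j : ℕ) : ℝ)⌋₊,
      copTauW (n * j) k * Real.log (M / ((n * j : ℕ) : ℝ) / k) ^ c) / Real.log M ^ c) with hS
  have key := vonMangoldt_mul_W_mul (j := j) hn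
  have hre : (Nat.totient n : ℝ) * Λ j * (W (n * j) * S) = (Nat.totient n : ℝ) * (Λ j * W (n * j)) * S := by
    ring
  rw [hre, key]
  by_cases hc : j.Prime ∧ ¬ j ∣ n
  · rw [if_pos hc, if_pos hc]; ring
  · rw [if_neg hc, if_neg hc]; ring

/-- **The kernel form of a general profile in Selberg coordinates.** For every real polynomial `P`, every real
`M` and `L`, with `x_m = μ(m)ψ(m)⁻¹P(log(M/m)/log M)`, `𝒮_n = Σ_c P_c S⁽ᶜ⁾(M/n;n)/logᶜM` and
`𝒫_n = Σ_{p ≤ ⌊M⌋/n, p∤n}(log p/(p+1))𝒮_{np}`: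
`Σ_{a,b ≤ M} x_a x_b K_L(a,b) = Σ_{n ≤ M} φ(n)W(n)²·((L + κ(n))·𝒮_n² + 2·𝒮_n·𝒫_n)`.
[cite: KowalskiMichelVanderKam2000, (21)–(23) and Prop. 5.1 — derivation] -/
theorem quadForm_profile_eq (P : ℝ[X]) (M L : ℝ) :
    ∑ a ∈ Icc 1 ⌊M⌋₊, ∑ b ∈ Icc 1 ⌊M⌋₊,
        ((μ a : ℝ) * ((psi a)⁻¹ * P.eval (Real.log (M / a) / Real.log M))) *
          ((μ b : ℝ) * ((psi b)⁻¹ * P.eval (Real.log (M / b) / Real.log M))) * kmvKernel L a b =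
      ∑ n ∈ Icc 1 ⌊M⌋₊, (Nat.totient n : ℝ) * W n ^ 2 *
        ((L + kappa n) *
            (∑ c ∈ Finset.range (P.natDegree + 1), P.coeff c *
              ((∑ k ∈ Icc 1 ⌊M / n⌋₊, copTauW n k * Real.log (M / n / k) ^ c) / Real.log M ^ c)) ^ 2 +
          2 * ((∑ c ∈ Finset.range (P.natDegree + 1), P.coeff c *
              ((∑ k ∈ Icc 1 ⌊M / n⌋₊, copTauW n k * Real.log (M / n / k) ^ c) / Real.log M ^ c)) *
            ∑ j ∈ Icc 1 (⌊M⌋₊ / n), if j.Prime ∧ ¬ j ∣ n then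
              Real.log j / ((j : ℝ) + 1) *
                ∑ c ∈ Finset.range (P.natDegree + 1), P.coeff c *
                  ((∑ k ∈ Icc 1 ⌊M / ((n * j : ℕ) : ℝ)⌋₊,
                    copTauW (n * j) k * Real.log (M / ((n * j : ℕ) : ℝ) / k) ^ c) / Real.log M ^ c)
              else 0)) := by
  set x : ℕ → ℝ := fun m ↦ (μ m : ℝ) * ((psi m)⁻¹ * P.eval (Real.log (M / m) / Real.log M)) with hxdef
  have hq := quadForm_kmvKernel_eq_scForm ⌊M⌋₊ L x
  simp only [hxdef] at hq
  rw [hq, scForm]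
  have hT1 : ∀ n ∈ Icc 1 ⌊M⌋₊, (Nat.totient n : ℝ) * (L + kappa n) * selA ⌊M⌋₊ x n ^ 2 =
      (Nat.totient n : ℝ) * W n ^ 2 * ((L + kappa n) *
        (∑ c ∈ Finset.range (P.natDegree + 1), P.coeff c *
          ((∑ k ∈ Icc 1 ⌊M / n⌋₊, copTauW n k * Real.log (M / n / k) ^ c) / Real.log M ^ c)) ^ 2) := by
    intro n hn
    have hn0 : n ≠ 0 := by have := (Finset.mem_Icc.1 hn).1; omega
    rw [hxdef, selA_profile P M hn0]
    ring
  have hT2 : ∀ n ∈ Icc 1 ⌊M⌋₊, ∑ m ∈ Icc 1 ⌊M⌋₊, wt n m * selA ⌊M⌋₊ x n * selA ⌊M⌋₊ x m =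
      -((Nat.totient n : ℝ) * W n ^ 2 *
        ((∑ c ∈ Finset.range (P.natDegree + 1), P.coeff c *
            ((∑ k ∈ Icc 1 ⌊M / n⌋₊, copTauW n k * Real.log (M / n / k) ^ c) / Real.log M ^ c)) *
          ∑ j ∈ Icc 1 (⌊M⌋₊ / n), if j.Prime ∧ ¬ j ∣ n then
            Real.log j / ((j : ℝ) + 1) *
              ∑ c ∈ Finset.range (P.natDegree + 1), P.coeff c *
                ((∑ k ∈ Icc 1 ⌊M / ((n * j : ℕ) : ℝ)⌋₊,
                  copTauW (n * j) k * Real.log (M / ((n * j : ℕ) : ℝ) / k) ^ c) / Real.log M ^ c)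
            else 0)) := by
    intro n hn
    have hn0 : n ≠ 0 := by have := (Finset.mem_Icc.1 hn).1; omega
    have hre : ∑ m ∈ Icc 1 ⌊M⌋₊, wt n m * selA ⌊M⌋₊ x n * selA ⌊M⌋₊ x m =
        selA ⌊M⌋₊ x n * ∑ m ∈ Icc 1 ⌊M⌋₊, wt n m * selA ⌊M⌋₊ x m := by
      rw [Finset.mul_sum]
      exact Finset.sum_congr rfl fun m _ ↦ by ring
    rw [hre, hxdef, sum_wt_selA_profile P M hn0, selA_profile P M hn0]
    ring
  simp only [hxdef] at hT1 hT2
  rw [Finset.sum_congr rfl hT1, Finset.sum_congr rfl hT2, Finset.mul_sum, ← Finset.sum_sub_distrib]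
  refine Finset.sum_congr rfl fun n _ ↦ ?_
  ring

end Summit.Parity.GeneralizedHardyLittlewood.Theorems.MomentsBeyondDiagonal.DiagKernel

end
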